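import Summits.CriticalPhenomena.PercolationContinuityZ3.Theorems.Transplant.FKDoubleFanSetLevel
import HarnessLib

/-!
# Double fans `K₂ ∨ P_{m+1}`: the GAUGE of the `a`-leg of a MULTIFAN₁ atom — a one-parameter family of `a`-gadgets with the SAME image,
# and the normal form `F_ab · F₁ = 0` of the `a`-leg

Helper file (`--supports stmt-CriticalPhenomena-4575`), FK sub-lane `prim-bschramm-fk-3` (gen 47); builds on p205010 (kernel theorem, internal
audit signed; external expert review pending).  Pure real algebra: no measures, no named facts, no sorries; standard axioms.
Memo `bschramm/prim-bschramm-fk-3/FAR-CROSS-XXII.md` §2.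

THE GAUGE.  For an `a`-gadget vector `F = (F₀, F_ab, F_ac, F_bc, F₁)` put `μ_F = F₀ + F_ab`, `λ_F = F_ac + F₁ + F_bc` and
**`gaugeF κ F`** `= κ·F + (1−κ)·(0, μ_F, 0, 0, λ_F)` (`κ ∈ ℝ`; `gaugeF 1 F = F`).  The endpoint gadget `F^∞ = gaugeF 0 F = μ_F·(detach ∘ P_a) + λ_F·P_a`
maps BOTH the input `u` and its pinned vector `AC_1 ∗ u` to the pinned image `σ = fanCombo q F (AC_1 ∗ u)` of `…DoubleFanSigma`
(**`fanCombo_gaugeF_zero`**, **`fanCombo_gaugeF_zero_pinned`**); consequently along the gauge the pinned image is constant and the unpinned image moves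
on the line through `σ`: `fanCombo q (gaugeF κ F) u = κ·fanCombo q F u + (1−κ)·σ` (**`fanCombo_gaugeF`**, **`fanCombo_gaugeF_pinned`**), so the
depth-1 `a`-PLANE `F_a·span(u, AC_1∗u)` does not depend on `κ` and its bivector scales:
**`imgA_gaugeF`**: `imgA q (gaugeF κ F) u = κ • imgA q F u`, and after any `b`-gadget **`imgAB_gaugeF`**: `imgAB q (gaugeF κ F) G u = κ • imgAB q F G u`.
NORMAL FORM.  With `κ₁ = μ_F/F₀` the gauge kills `F_ab`
(**`gaugeF_zab_eq_zero`**), with `κ₂ = λ_F/(F_ac+F_bc)` it kills `F₁` (**`gaugeF_z1_eq_zero`**), and for `0 ≤ κ ≤ min(κ₁, κ₂)` all masses stay `≥ 0`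
(**`gaugeF_nonneg`**); hence (**`exists_gauge_normalForm`**) every `a`-gadget with non-negative masses and `F₀ > 0`, `F_ac + F_bc > 0` is gauge-equivalent,
with a factor `κ > 0`, to one with non-negative masses and `F_ab = 0 ∨ F₁ = 0` — the exact reason behind the numerical observation "the `a`-leg of a
set-level representation can always be taken with `F'_ab = 0`" (memo FAR-CROSS-XX §2, kit j297801).  The MULTIFAN₁ cone `coneAB` and every cone-level
statement are blind to the gauge (`imgAB_gaugeF`); set-level statements (`mfAtomSet`) see it only through the leg class.
[cite: Grimmett2006, §3.9 eq. (3.94) (pp. 63–64)] [folklore]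
-/

noncomputable section

namespace Summit.CriticalPhenomena.PercolationContinuityZ3.Theorems

namespace FK

namespace ThreeApex

/-! ### The gauge family of an `a`-gadget -/

/-- **The gauge deformation** of an `a`-gadget vector: `gaugeF κ F = κ·F + (1−κ)·(0, F₀+F_ab, 0, 0, F_ac+F₁+F_bc)`. [folklore] -/
def gaugeF (κ : ℝ) (F : V5) : V5 :=
  ⟨κ * F.z0, F.z0 + F.zab - κ * F.z0, κ * F.zac, κ * F.zbc, F.zac + F.z1 + F.zbc - κ * (F.zac + F.zbc)⟩

/-- `κ = 1` is the gadget itself. [folklore] -/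
theorem gaugeF_one (F : V5) : gaugeF 1 F = F := by
  ext <;> simp [gaugeF]

/-- `κ = 0` is the endpoint `F^∞ = (0, μ_F, 0, 0, λ_F)`. [folklore] -/
theorem gaugeF_zero (F : V5) : gaugeF 0 F = ⟨0, F.z0 + F.zab, 0, 0, F.zac + F.z1 + F.zbc⟩ := by
  ext <;> simp [gaugeF]

/-- The gauge keeps `μ_F = F₀ + F_ab`. [folklore] -/
theorem gaugeF_mu (κ : ℝ) (F : V5) : (gaugeF κ F).z0 + (gaugeF κ F).zab = F.z0 + F.zab := by
  simp only [gaugeF]; ring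

/-- The gauge keeps `λ_F = F_ac + F₁ + F_bc`. [folklore] -/
theorem gaugeF_lam (κ : ℝ) (F : V5) :
    (gaugeF κ F).zac + (gaugeF κ F).z1 + (gaugeF κ F).zbc = F.zac + F.z1 + F.zbc := by
  simp only [gaugeF]; ring

/-- The gauge is a one-parameter group up to reparametrisation: `gaugeF κ (gaugeF κ' F) = gaugeF (κκ') F`. [folklore] -/
theorem gaugeF_gaugeF (κ κ' : ℝ) (F : V5) : gaugeF κ (gaugeF κ' F) = gaugeF (κ * κ') F := by
  ext <;> simp only [gaugeF] <;> ring

/-! ### The mechanism: the endpoint gadget collapses the input plane onto the pinned image -/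

/-- **The endpoint gadget maps the input to the pinned image**: `fanCombo q F^∞ u = fanCombo q F (AC_1 ∗ u)` (`= λ_F·π + μ_F·detach π`, `π = AC_1∗u`). [folklore] -/
theorem fanCombo_gaugeF_zero (q : ℝ) (F u : V5) : fanCombo q (gaugeF 0 F) u = fanCombo q F (conv (edgeAC 1) u) := by
  ext <;> simp only [fanCombo, gaugeF, conv, edgeAC, detach, V5.total] <;> ring

/-- …and maps the pinned vector to the same pinned image. [folklore] -/
theorem fanCombo_gaugeF_zero_pinned (q : ℝ) (F u : V5) :
    fanCombo q (gaugeF 0 F) (conv (edgeAC 1) u) = fanCombo q F (conv (edgeAC 1) u) := by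
  ext <;> simp only [fanCombo, gaugeF, conv, edgeAC, detach, V5.total] <;> ring

/-- **The pinned image is gauge invariant**: `fanCombo q (gaugeF κ F) (AC_1∗u) = fanCombo q F (AC_1∗u)` for every `κ`. [folklore] -/
theorem fanCombo_gaugeF_pinned (q κ : ℝ) (F u : V5) :
    fanCombo q (gaugeF κ F) (conv (edgeAC 1) u) = fanCombo q F (conv (edgeAC 1) u) := by
  ext <;> simp only [fanCombo, gaugeF, conv, edgeAC, detach, V5.total] <;> ring

/-- **The unpinned image moves on the line through the pinned one**: componentwise
`fanCombo q (gaugeF κ F) u = κ·fanCombo q F u + (1−κ)·fanCombo q F (AC_1∗u)`. [folklore] -/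
theorem fanCombo_gaugeF (q κ : ℝ) (F u : V5) :
    fanCombo q (gaugeF κ F) u =
      ⟨κ * (fanCombo q F u).z0 + (1 - κ) * (fanCombo q F (conv (edgeAC 1) u)).z0,
       κ * (fanCombo q F u).zab + (1 - κ) * (fanCombo q F (conv (edgeAC 1) u)).zab,
       κ * (fanCombo q F u).zac + (1 - κ) * (fanCombo q F (conv (edgeAC 1) u)).zac,
       κ * (fanCombo q F u).zbc + (1 - κ) * (fanCombo q F (conv (edgeAC 1) u)).zbc,
       κ * (fanCombo q F u).z1 + (1 - κ) * (fanCombo q F (conv (edgeAC 1) u)).z1⟩ := by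
  ext <;> simp only [fanCombo, gaugeF, conv, edgeAC, detach, V5.total] <;> ring

/-! ### The images scale: the depth-1 `a`-plane and the MULTIFAN₁ plane are gauge invariant -/

/-- **`imgA q (gaugeF κ F) u = κ • imgA q F u`** (all `q, κ, F, u`). [folklore] -/
theorem imgA_gaugeF (q κ : ℝ) (F u : V5) : imgA q (gaugeF κ F) u = Biv.smul κ (imgA q F u) := by
  ext <;> simp only [imgA, wedgeH, fanCombo, gaugeF, conv, edgeAC, detach, hx, hy, hz, V5.total, Biv.smul] <;> ring

/-- `b`-gadgets act linearly (affine combinations of the argument, componentwise). [folklore] -/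
theorem fanComboB_affine (q κ : ℝ) (G X Y : V5) :
    fanComboB q G ⟨κ * X.z0 + (1 - κ) * Y.z0, κ * X.zab + (1 - κ) * Y.zab, κ * X.zac + (1 - κ) * Y.zac, κ * X.zbc + (1 - κ) * Y.zbc,
        κ * X.z1 + (1 - κ) * Y.z1⟩ =
      ⟨κ * (fanComboB q G X).z0 + (1 - κ) * (fanComboB q G Y).z0, κ * (fanComboB q G X).zab + (1 - κ) * (fanComboB q G Y).zab,
        κ * (fanComboB q G X).zac + (1 - κ) * (fanComboB q G Y).zac, κ * (fanComboB q G X).zbc + (1 - κ) * (fanComboB q G Y).zbc,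
        κ * (fanComboB q G X).z1 + (1 - κ) * (fanComboB q G Y).z1⟩ := by
  ext <;> simp only [fanComboB, conv, edgeBC, detach, V5.total] <;> ring

/-- The wedge is alternating and linear in its first argument: `(κX + (1−κ)Y) ∧ Y = κ·(X ∧ Y)`. [folklore] -/
theorem wedgeH_affine_left (κ : ℝ) (X Y : V5) :
    wedgeH ⟨κ * X.z0 + (1 - κ) * Y.z0, κ * X.zab + (1 - κ) * Y.zab, κ * X.zac + (1 - κ) * Y.zac, κ * X.zbc + (1 - κ) * Y.zbc,
        κ * X.z1 + (1 - κ) * Y.z1⟩ Y = Biv.smul κ (wedgeH X Y) := by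
  ext <;> simp only [wedgeH, hx, hy, hz, V5.total, Biv.smul] <;> ring

/-- **`imgAB q (gaugeF κ F) G u = κ • imgAB q F G u`** (all `q, κ, F, G, u`): the MULTIFAN₁ image sees the `a`-leg only through its gauge class. [folklore] -/
theorem imgAB_gaugeF (q κ : ℝ) (F G u : V5) : imgAB q (gaugeF κ F) G u = Biv.smul κ (imgAB q F G u) := by
  have h0 : fanCombo q (gaugeF κ F) (conv (edgeAC 0) u) =
      ⟨κ * (fanCombo q F (conv (edgeAC 0) u)).z0 + (1 - κ) * (fanCombo q F (conv (edgeAC 1) u)).z0,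
       κ * (fanCombo q F (conv (edgeAC 0) u)).zab + (1 - κ) * (fanCombo q F (conv (edgeAC 1) u)).zab,
       κ * (fanCombo q F (conv (edgeAC 0) u)).zac + (1 - κ) * (fanCombo q F (conv (edgeAC 1) u)).zac,
       κ * (fanCombo q F (conv (edgeAC 0) u)).zbc + (1 - κ) * (fanCombo q F (conv (edgeAC 1) u)).zbc,
       κ * (fanCombo q F (conv (edgeAC 0) u)).z1 + (1 - κ) * (fanCombo q F (conv (edgeAC 1) u)).z1⟩ := by
    rw [conv_edgeAC_zero]; exact fanCombo_gaugeF q κ F u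
  have h1 : fanCombo q (gaugeF κ F) (conv (edgeAC 1) u) = fanCombo q F (conv (edgeAC 1) u) := fanCombo_gaugeF_pinned q κ F u
  simp only [imgAB, h0, h1, fanComboB_affine, wedgeH_affine_left]

/-- The MULTIFAN₁ cone is blind to the gauge: for `κ ≥ 0`, `imgAB q (gaugeF κ F) G u ∈ coneAB q` whenever `imgAB q F G u ∈ coneAB q`. [folklore] -/
theorem imgAB_gaugeF_mem_coneAB {q κ : ℝ} (hκ : 0 ≤ κ) {F G u : V5} (h : imgAB q F G u ∈ coneAB q) : imgAB q (gaugeF κ F) G u ∈ coneAB q := by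
  intro γ hγ
  rw [imgAB_gaugeF, pairH_smul_left]
  exact mul_nonneg hκ (h γ hγ)

/-! ### The normal form `F_ab · F₁ = 0` -/

/-- With `κ₁ = μ_F/F₀` the gauge kills `F_ab` (`F₀ ≠ 0`). [folklore] -/
theorem gaugeF_zab_eq_zero {F : V5} (h0 : F.z0 ≠ 0) : (gaugeF ((F.z0 + F.zab) / F.z0) F).zab = 0 := by
  simp only [gaugeF]
  field_simp
  ring

/-- With `κ₂ = λ_F/(F_ac + F_bc)` the gauge kills `F₁` (`F_ac + F_bc ≠ 0`). [folklore] -/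
theorem gaugeF_z1_eq_zero {F : V5} (h : F.zac + F.zbc ≠ 0) : (gaugeF ((F.zac + F.z1 + F.zbc) / (F.zac + F.zbc)) F).z1 = 0 := by
  simp only [gaugeF]
  field_simp
  ring

/-- **Masses stay non-negative along the gauge** for `0 ≤ κ`, `κ·F₀ ≤ μ_F` and `κ·(F_ac + F_bc) ≤ λ_F`. [folklore] -/
theorem gaugeF_nonneg {κ : ℝ} {F : V5} (hF : F.Nonneg) (hκ : 0 ≤ κ) (h1 : κ * F.z0 ≤ F.z0 + F.zab)
    (h2 : κ * (F.zac + F.zbc) ≤ F.zac + F.z1 + F.zbc) : (gaugeF κ F).Nonneg := by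
  obtain ⟨h0, hab, hac, hbc, h1'⟩ := hF
  refine ⟨?_, ?_, ?_, ?_, ?_⟩ <;> simp only [gaugeF]
  · exact mul_nonneg hκ h0
  · linarith
  · exact mul_nonneg hκ hac
  · exact mul_nonneg hκ hbc
  · linarith

/-- **Normal form of the `a`-leg.**  If `F` has non-negative masses, `F₀ > 0` and `F_ac + F_bc > 0`, then for some `κ > 0` the gauge-equivalent gadget
`gaugeF κ F` has non-negative masses and `F_ab = 0 ∨ F₁ = 0`; its images are `κ •` those of `F` (`imgA_gaugeF`, `imgAB_gaugeF`). [folklore] -/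
theorem exists_gauge_normalForm {F : V5} (hF : F.Nonneg) (h0 : 0 < F.z0) (hc : 0 < F.zac + F.zbc) :
    ∃ κ : ℝ, 0 < κ ∧ (gaugeF κ F).Nonneg ∧ ((gaugeF κ F).zab = 0 ∨ (gaugeF κ F).z1 = 0) := by
  obtain ⟨hz0, hab, hac, hbc, h1⟩ := hF
  set κ₁ := (F.z0 + F.zab) / F.z0 with hκ₁
  set κ₂ := (F.zac + F.z1 + F.zbc) / (F.zac + F.zbc) with hκ₂
  have hκ₁pos : 0 < κ₁ := div_pos (by linarith) h0
  have hκ₂pos : 0 < κ₂ := div_pos (by linarith) hc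
  have e1 : κ₁ * F.z0 = F.z0 + F.zab := by rw [hκ₁]; field_simp
  have e2 : κ₂ * (F.zac + F.zbc) = F.zac + F.z1 + F.zbc := by rw [hκ₂]; field_simp
  rcases le_total κ₁ κ₂ with hle | hle
  · refine ⟨κ₁, hκ₁pos, gaugeF_nonneg ⟨hz0, hab, hac, hbc, h1⟩ hκ₁pos.le (le_of_eq e1) ?_, Or.inl ?_⟩
    · calc κ₁ * (F.zac + F.zbc) ≤ κ₂ * (F.zac + F.zbc) := mul_le_mul_of_nonneg_right hle hc.le
        _ = F.zac + F.z1 + F.zbc := e2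
    · rw [hκ₁]; exact gaugeF_zab_eq_zero h0.ne'
  · refine ⟨κ₂, hκ₂pos, gaugeF_nonneg ⟨hz0, hab, hac, hbc, h1⟩ hκ₂pos.le ?_ (le_of_eq e2), Or.inr ?_⟩
    · calc κ₂ * F.z0 ≤ κ₁ * F.z0 := mul_le_mul_of_nonneg_right hle h0.le
        _ = F.z0 + F.zab := e1
    · rw [hκ₂]; exact gaugeF_z1_eq_zero hc.ne'

end ThreeApex

end FK

end Summit.CriticalPhenomena.PercolationContinuityZ3.Theorems
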